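import Summits.Ventures.PercRepro.S1CoreCapFat

/-!
# PercRepro — the `(3 classes, 2 fat)` entry of the 4-circuit cap table is 3 (p1, gen 22; the s₄ seat)

`proofs/P1-S4-PERPOINT.md` §9.3 (b) / `proofs/P1-S4-CAPBRIDGE.md` §3. A 6-point plane `P ∋ e` of the e-free core
whose line of `M ／ {e}` has three classes, two of them fat (two M-lines `{e, p, q}`, `{e, r, s}` through `e`),
carries at most 3 four-circuits through `e`: of the 10 triples of `P ∖ {e}`, the two lines kill `3 + 3`, and the
rank-2 triple through the sixth point `t` (`S1CoreSixPlane.exists_triple_through_of_ncard_six`) — which cannot pass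
through `e` nor lie on either line, so it meets each line in exactly one point — kills a seventh. With
`S1CoreCapFat` (entries 2 / 4) and `S1CoreCapFive` (cap(5) = 5) every entry of the PAPER table `1 / 4 / 5`,
`2 / 5 / 3` is a Lean fact.
Axioms: standard.
-/

open scoped Matroid

namespace PercRepro

namespace S1

open Set

variable {α : Type}

/-- Two rank-2 triples of the core sharing two points coincide. -/
theorem eq_of_triples_share_pair (M : Matroid α) [M.Finite]
    (hfree : ∀ e ∈ M.E, ∃ A ⊆ M.E \ {e}, e ∉ M.closure A ∧ e ∉ M.closure ((M.E \ {e}) \ A))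
    {T T' : Set α} (hT : T ⊆ M.E) (hT' : T' ⊆ M.E) (hrT : M.eRk T ≤ 2) (hrT' : M.eRk T' ≤ 2)
    (h3 : T.ncard = 3) (h3' : T'.ncard = 3) {a b : α} (hab : a ≠ b) (haT : a ∈ T) (haT' : a ∈ T')
    (hbT : b ∈ T) (hbT' : b ∈ T') : T = T' := by
  by_contra hne
  have h := inter_ncard_le_one_of_triples M hfree hT hT' hrT hrT' h3 h3' hne
  have hsub : ({a, b} : Set α) ⊆ T ∩ T' := by
    intro t ht; simp only [mem_insert_iff, mem_singleton_iff] at ht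
    rcases ht with rfl | rfl
    · exact ⟨haT, haT'⟩
    · exact ⟨hbT, hbT'⟩
  have := ncard_le_ncard hsub ((M.ground_finite.subset hT).subset inter_subset_left)
  rw [ncard_pair hab] at this
  omega

/-- The six points of a 6-point plane `P ⊇ {e, p, q, r, s, t}`, all distinct, are all of `P`. -/
theorem eq_of_six_distinct_subset {P : Set α} (hPfin : P.Finite) (h6 : P.ncard = 6) {e p q r s t : α}
    (he : e ∈ P) (hp : p ∈ P) (hq : q ∈ P) (hr : r ∈ P) (hs : s ∈ P) (ht : t ∈ P)
    (hpe : p ≠ e) (hqe : q ≠ e) (hre : r ≠ e) (hse : s ≠ e) (hte : t ≠ e) (hpq : p ≠ q) (hpr : p ≠ r)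
    (hps : p ≠ s) (hpt : p ≠ t) (hqr : q ≠ r) (hqs : q ≠ s) (hqt : q ≠ t) (hrs : r ≠ s) (hrt : r ≠ t)
    (hst : s ≠ t) : P = {e, p, q, r, s, t} := by
  have hsub : ({e, p, q, r, s, t} : Set α) ⊆ P := by
    intro x hx; simp only [mem_insert_iff, mem_singleton_iff] at hx
    rcases hx with rfl | rfl | rfl | rfl | rfl | rfl <;> assumption
  have h1 : e ∉ ({p, q, r, s, t} : Set α) := by
    simp only [mem_insert_iff, mem_singleton_iff, not_or]
    exact ⟨hpe.symm, hqe.symm, hre.symm, hse.symm, hte.symm⟩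
  have h2 : p ∉ ({q, r, s, t} : Set α) := by
    simp only [mem_insert_iff, mem_singleton_iff, not_or]
    exact ⟨hpq, hpr, hps, hpt⟩
  have h3 : q ∉ ({r, s, t} : Set α) := by
    simp only [mem_insert_iff, mem_singleton_iff, not_or]
    exact ⟨hqr, hqs, hqt⟩
  have h4 : r ∉ ({s, t} : Set α) := by
    simp only [mem_insert_iff, mem_singleton_iff, not_or]
    exact ⟨hrs, hrt⟩
  have h5 : s ∉ ({t} : Set α) := by
    simp only [mem_singleton_iff]
    exact hst
  have hc : ({e, p, q, r, s, t} : Set α).ncard = 6 := by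
    rw [ncard_insert_of_notMem h1, ncard_insert_of_notMem h2, ncard_insert_of_notMem h3, ncard_insert_of_notMem h4,
      ncard_insert_of_notMem h5, ncard_singleton]
  exact (eq_of_subset_of_ncard_le hsub (by omega) hPfin).symm

/-- **The `(3 classes, 2 fat)` entry of the paper table**: a 6-point plane `P ∋ e` of the core with two M-lines
`{e, p, q}`, `{e, r, s}` through `e` carries at most 3 four-circuits through `e` (the kill count: the two lines
kill `3 + 3` of the 10 triples of `P ∖ {e}`, and the rank-2 triple through the sixth point `t` (`S1CoreSixPlane`),
which meets each line in one point, kills a seventh). -/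
theorem ncard_fourCircuitsThrough_in_six_plane_two_fat_le_three (M : Matroid α) [M.Finite]
    (hfree : ∀ e ∈ M.E, ∃ A ⊆ M.E \ {e}, e ∉ M.closure A ∧ e ∉ M.closure ((M.E \ {e}) \ A))
    {P : Set α} (hP : P ⊆ M.E) (hrP : M.eRk P ≤ 3) (h6 : P.ncard = 6) {e p q r s : α} (he : e ∈ P)
    (hp : p ∈ P) (hq : q ∈ P) (hr' : r ∈ P) (hs : s ∈ P) (hpe : p ≠ e) (hqe : q ≠ e) (hre : r ≠ e)
    (hse : s ≠ e) (hpq : p ≠ q) (hrs : r ≠ s) (hpr : p ≠ r) (hps : p ≠ s) (hqr : q ≠ r) (hqs : q ≠ s)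
    (hr1 : M.eRk {e, p, q} ≤ 2) (hr2 : M.eRk {e, r, s} ≤ 2) :
    {C : Set α | M.IsCircuit C ∧ C.ncard = 4 ∧ e ∈ C ∧ C ⊆ P}.ncard ≤ 3 := by
  classical
  have hPfin : P.Finite := M.ground_finite.subset hP
  have hQfin : (P \ {e}).Finite := hPfin.subset sdiff_subset
  have hQ5 : (P \ {e}).ncard = 5 := by
    have := ncard_sdiff_singleton_add_one he hPfin; omega
  -- the sixth point `t`
  have hnot : ¬ P \ {e} ⊆ ({p, q, r, s} : Set α) := by
    intro hsub
    have := ncard_le_ncard hsub (toFinite _)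
    have h4 : ({p, q, r, s} : Set α).ncard ≤ 4 := by
      refine (ncard_insert_le _ _).trans ?_
      refine (Nat.add_le_add_right (ncard_insert_le _ _) 1).trans ?_
      refine (Nat.add_le_add_right (Nat.add_le_add_right (ncard_insert_le _ _) 1) 1).trans ?_
      rw [ncard_singleton]
    omega
  obtain ⟨t, htQ, htn⟩ := not_subset.1 hnot
  simp only [mem_insert_iff, mem_singleton_iff, not_or] at htn
  obtain ⟨htp, htq, htr, hts⟩ := htn
  have htP : t ∈ P := htQ.1
  have hte : t ≠ e := fun h => htQ.2 (mem_singleton_iff.2 h)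
  have hPeq : P = {e, p, q, r, s, t} :=
    eq_of_six_distinct_subset hPfin h6 he hp hq hr' hs htP hpe hqe hre hse hte hpq hpr hps
      (Ne.symm htp) hqr hqs (Ne.symm htq) hrs (Ne.symm htr) (Ne.symm hts)
  have hmemP : ∀ x ∈ P, x = e ∨ x = p ∨ x = q ∨ x = r ∨ x = s ∨ x = t := by
    intro x hx; rw [hPeq] at hx; simpa only [mem_insert_iff, mem_singleton_iff] using hx
  -- the rank-2 triple through `t`
  obtain ⟨u, huP, v, hvP, huv, hut, hvt, hruv⟩ := exists_triple_through_of_ncard_six M hfree hP hrP h6 htP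
  have hT1 : ({e, p, q} : Set α) ⊆ M.E := by
    intro x hx; simp only [mem_insert_iff, mem_singleton_iff] at hx
    rcases hx with rfl | rfl | rfl <;> exact hP (by assumption)
  have hT2 : ({e, r, s} : Set α) ⊆ M.E := by
    intro x hx; simp only [mem_insert_iff, mem_singleton_iff] at hx
    rcases hx with rfl | rfl | rfl <;> exact hP (by assumption)
  have hT3 : ({t, u, v} : Set α) ⊆ M.E := by
    intro x hx; simp only [mem_insert_iff, mem_singleton_iff] at hx
    rcases hx with rfl | rfl | rfl <;> exact hP (by assumption)
  have hc1 : ({e, p, q} : Set α).ncard = 3 := ncard_eq_three.2 ⟨e, p, q, hpe.symm, hqe.symm, hpq, rfl⟩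
  have hc2 : ({e, r, s} : Set α).ncard = 3 := ncard_eq_three.2 ⟨e, r, s, hre.symm, hse.symm, hrs, rfl⟩
  have hc3 : ({t, u, v} : Set α).ncard = 3 := ncard_eq_three.2 ⟨t, u, v, hut.symm, hvt.symm, huv, rfl⟩
  -- a point `x ∈ {p, q}` (resp. `{r, s}`) with `{t, e, x}` of rank 2 is impossible: that triple equals the line
  have hkill_e : ∀ x, (x = p ∨ x = q ∨ x = r ∨ x = s) → x ≠ t → ¬ (M.eRk {t, e, x} ≤ 2) := by
    intro x hx hxt hrk
    have hxP : x ∈ P := by rcases hx with rfl | rfl | rfl | rfl <;> assumption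
    have hxe : x ≠ e := by rcases hx with rfl | rfl | rfl | rfl <;> assumption
    have hT : ({t, e, x} : Set α) ⊆ M.E := by
      intro y hy; simp only [mem_insert_iff, mem_singleton_iff] at hy
      rcases hy with rfl | rfl | rfl <;> exact hP (by assumption)
    have hc : ({t, e, x} : Set α).ncard = 3 := ncard_eq_three.2 ⟨t, e, x, hte, hxt.symm, hxe.symm, rfl⟩
    rcases hx with hx | hx | hx | hx
    · subst x
      have := eq_of_triples_share_pair M hfree hT hT1 hrk hr1 hc hc1 hpe.symm (by simp) (by simp) (by simp) (by simp)
      have ht' : t ∈ ({e, p, q} : Set α) := by rw [← this]; simp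
      simp only [mem_insert_iff, mem_singleton_iff] at ht'
      rcases ht' with h | h | h
      · exact hte h
      · exact htp h
      · exact htq h
    · subst x
      have := eq_of_triples_share_pair M hfree hT hT1 hrk hr1 hc hc1 hqe.symm (by simp) (by simp) (by simp) (by simp)
      have ht' : t ∈ ({e, p, q} : Set α) := by rw [← this]; simp
      simp only [mem_insert_iff, mem_singleton_iff] at ht'
      rcases ht' with h | h | h
      · exact hte h
      · exact htp h
      · exact htq h
    · subst x
      have := eq_of_triples_share_pair M hfree hT hT2 hrk hr2 hc hc2 hre.symm (by simp) (by simp) (by simp) (by simp)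
      have ht' : t ∈ ({e, r, s} : Set α) := by rw [← this]; simp
      simp only [mem_insert_iff, mem_singleton_iff] at ht'
      rcases ht' with h | h | h
      · exact hte h
      · exact htr h
      · exact hts h
    · subst x
      have := eq_of_triples_share_pair M hfree hT hT2 hrk hr2 hc hc2 hse.symm (by simp) (by simp) (by simp) (by simp)
      have ht' : t ∈ ({e, r, s} : Set α) := by rw [← this]; simp
      simp only [mem_insert_iff, mem_singleton_iff] at ht'
      rcases ht' with h | h | h
      · exact hte h
      · exact htr h
      · exact hts h
  -- `{t, p, q}` and `{t, r, s}` are not rank-2 triples either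
  have hkill_pq : ¬ (M.eRk {t, p, q} ≤ 2) := by
    intro hrk
    have hT : ({t, p, q} : Set α) ⊆ M.E := by
      intro y hy; simp only [mem_insert_iff, mem_singleton_iff] at hy
      rcases hy with rfl | rfl | rfl <;> exact hP (by assumption)
    have hc : ({t, p, q} : Set α).ncard = 3 := ncard_eq_three.2 ⟨t, p, q, htp, htq, hpq, rfl⟩
    have := eq_of_triples_share_pair M hfree hT hT1 hrk hr1 hc hc1 hpq (by simp) (by simp) (by simp) (by simp)
    have ht' : t ∈ ({e, p, q} : Set α) := by rw [← this]; simp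
    simp only [mem_insert_iff, mem_singleton_iff] at ht'
    rcases ht' with h | h | h
    · exact hte h
    · exact htp h
    · exact htq h
  have hkill_rs : ¬ (M.eRk {t, r, s} ≤ 2) := by
    intro hrk
    have hT : ({t, r, s} : Set α) ⊆ M.E := by
      intro y hy; simp only [mem_insert_iff, mem_singleton_iff] at hy
      rcases hy with rfl | rfl | rfl <;> exact hP (by assumption)
    have hc : ({t, r, s} : Set α).ncard = 3 := ncard_eq_three.2 ⟨t, r, s, htr, hts, hrs, rfl⟩
    have := eq_of_triples_share_pair M hfree hT hT2 hrk hr2 hc hc2 hrs (by simp) (by simp) (by simp) (by simp)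
    have ht' : t ∈ ({e, r, s} : Set α) := by rw [← this]; simp
    simp only [mem_insert_iff, mem_singleton_iff] at ht'
    rcases ht' with h | h | h
    · exact hte h
    · exact htr h
    · exact hts h
  -- `u, v` are among `p, q, r, s`, one in each line
  have hmem4 : ∀ x ∈ P, x ≠ e → x ≠ t → (x = p ∨ x = q ∨ x = r ∨ x = s) := by
    intro x hx hxe hxt
    rcases hmemP x hx with h | h | h | h | h | h
    · exact absurd h hxe
    · exact Or.inl h
    · exact Or.inr (Or.inl h)
    · exact Or.inr (Or.inr (Or.inl h))
    · exact Or.inr (Or.inr (Or.inr h))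
    · exact absurd h hxt
  have hue : u ≠ e := by
    rintro rfl
    exact hkill_e v (hmem4 v hvP (Ne.symm huv) hvt) hvt hruv
  have hve : v ≠ e := by
    rintro rfl
    rw [pair_comm] at hruv
    exact hkill_e u (hmem4 u huP huv hut) hut hruv
  have hu4 := hmem4 u huP hue hut
  have hv4 := hmem4 v hvP hve hvt
  have hab : ∃ a b, (a = p ∨ a = q) ∧ (b = r ∨ b = s) ∧ ({t, u, v} : Set α) = {t, a, b} := by
    rcases hu4 with rfl | rfl | rfl | rfl <;> rcases hv4 with rfl | rfl | rfl | rfl <;>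
    first
    | exact absurd rfl huv
    | exact absurd hruv hkill_pq
    | exact absurd hruv hkill_rs
    | (rw [pair_comm] at hruv; exact absurd hruv hkill_pq)
    | (rw [pair_comm] at hruv; exact absurd hruv hkill_rs)
    | exact ⟨_, _, Or.inl rfl, Or.inl rfl, rfl⟩
    | exact ⟨_, _, Or.inl rfl, Or.inr rfl, rfl⟩
    | exact ⟨_, _, Or.inr rfl, Or.inl rfl, rfl⟩
    | exact ⟨_, _, Or.inr rfl, Or.inr rfl, rfl⟩
    | (rw [pair_comm]; exact ⟨_, _, Or.inl rfl, Or.inl rfl, rfl⟩)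
    | (rw [pair_comm]; exact ⟨_, _, Or.inl rfl, Or.inr rfl, rfl⟩)
    | (rw [pair_comm]; exact ⟨_, _, Or.inr rfl, Or.inl rfl, rfl⟩)
    | (rw [pair_comm]; exact ⟨_, _, Or.inr rfl, Or.inr rfl, rfl⟩)
  obtain ⟨a, b, ha, hb, hT3eq⟩ := hab
  rw [hT3eq] at hruv hc3 hT3
  have haP : a ∈ P := by rcases ha with rfl | rfl <;> assumption
  have hbP : b ∈ P := by rcases hb with rfl | rfl <;> assumption
  have hae : a ≠ e := by rcases ha with rfl | rfl <;> assumption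
  have hbe : b ≠ e := by rcases hb with rfl | rfl <;> assumption
  have hat : a ≠ t := by rcases ha with rfl | rfl <;> exact Ne.symm (by assumption)
  have hbt : b ≠ t := by rcases hb with rfl | rfl <;> exact Ne.symm (by assumption)
  have hab' : a ≠ b := by rcases ha with rfl | rfl <;> rcases hb with rfl | rfl <;> assumption
  -- the kill set: the 3 triples through `{p, q}`, the 3 through `{r, s}`, and `{t, a, b}`
  have hK1c : {S : Set α | S ⊆ P \ {e} ∧ S.ncard = 3 ∧ p ∈ S ∧ q ∈ S}.ncard = 3 := by
    rw [ncard_triples_through_pair (P \ {e}) hQfin ⟨hp, hpe⟩ ⟨hq, hqe⟩ hpq, hQ5]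
  have hK2c : {S : Set α | S ⊆ P \ {e} ∧ S.ncard = 3 ∧ r ∈ S ∧ s ∈ S}.ncard = 3 := by
    rw [ncard_triples_through_pair (P \ {e}) hQfin ⟨hr', hre⟩ ⟨hs, hse⟩ hrs, hQ5]
  have h𝒯fin : {S : Set α | S ⊆ P \ {e} ∧ S.ncard = 3}.Finite := hQfin.finite_subsets.subset (fun S hS => hS.1)
  have hK1sub : {S : Set α | S ⊆ P \ {e} ∧ S.ncard = 3 ∧ p ∈ S ∧ q ∈ S} ⊆ {S : Set α | S ⊆ P \ {e} ∧ S.ncard = 3} :=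
    fun S hS => ⟨hS.1, hS.2.1⟩
  have hK2sub : {S : Set α | S ⊆ P \ {e} ∧ S.ncard = 3 ∧ r ∈ S ∧ s ∈ S} ⊆ {S : Set α | S ⊆ P \ {e} ∧ S.ncard = 3} :=
    fun S hS => ⟨hS.1, hS.2.1⟩
  have hdisj : Disjoint {S : Set α | S ⊆ P \ {e} ∧ S.ncard = 3 ∧ p ∈ S ∧ q ∈ S}
      {S : Set α | S ⊆ P \ {e} ∧ S.ncard = 3 ∧ r ∈ S ∧ s ∈ S} := by
    rw [Set.disjoint_left]
    rintro S ⟨hSQ, hS3, hpS, hqS⟩ ⟨_, _, hrS, hsS⟩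
    have hsub : ({p, q, r, s} : Set α) ⊆ S := by
      intro x hx; simp only [mem_insert_iff, mem_singleton_iff] at hx
      rcases hx with rfl | rfl | rfl | rfl <;> assumption
    have h4 : ({p, q, r, s} : Set α).ncard = 4 := by
      rw [ncard_insert_of_notMem (by simp only [mem_insert_iff, mem_singleton_iff, not_or]; exact ⟨hpq, hpr, hps⟩),
        ncard_insert_of_notMem (by simp only [mem_insert_iff, mem_singleton_iff, not_or]; exact ⟨hqr, hqs⟩),
        ncard_insert_of_notMem (by simp only [mem_singleton_iff]; exact hrs), ncard_singleton]
    have := ncard_le_ncard hsub (hQfin.subset hSQ)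
    omega
  have hS3Q : ({t, a, b} : Set α) ⊆ P \ {e} := by
    intro x hx; simp only [mem_insert_iff, mem_singleton_iff] at hx
    rcases hx with rfl | rfl | rfl
    · exact ⟨htP, fun h => hte (mem_singleton_iff.1 h)⟩
    · exact ⟨haP, fun h => hae (mem_singleton_iff.1 h)⟩
    · exact ⟨hbP, fun h => hbe (mem_singleton_iff.1 h)⟩
  have hS3notin : ({t, a, b} : Set α) ∉ {S : Set α | S ⊆ P \ {e} ∧ S.ncard = 3 ∧ p ∈ S ∧ q ∈ S} ∪
      {S : Set α | S ⊆ P \ {e} ∧ S.ncard = 3 ∧ r ∈ S ∧ s ∈ S} := by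
    rintro (⟨_, _, hpS, hqS⟩ | ⟨_, _, hrS, hsS⟩)
    · simp only [mem_insert_iff, mem_singleton_iff] at hpS hqS
      rcases ha with rfl | rfl <;> rcases hb with rfl | rfl <;> rcases hpS with h | h | h <;>
        rcases hqS with h' | h' | h' <;> subst_vars <;>
        first
        | exact absurd rfl hpq | exact absurd rfl hqr | exact absurd rfl hqs | exact absurd rfl hpr
        | exact absurd rfl hps | exact absurd rfl hrs | exact absurd rfl htp | exact absurd rfl htq
    · simp only [mem_insert_iff, mem_singleton_iff] at hrS hsS
      rcases ha with rfl | rfl <;> rcases hb with rfl | rfl <;> rcases hrS with h | h | h <;>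
        rcases hsS with h' | h' | h' <;> subst_vars <;>
        first
        | exact absurd rfl hpq | exact absurd rfl hqr | exact absurd rfl hqs | exact absurd rfl hpr
        | exact absurd rfl hps | exact absurd rfl hrs | exact absurd rfl htp | exact absurd rfl htq
        | exact absurd rfl htr | exact absurd rfl hts
  have hKc : (insert ({t, a, b} : Set α) ({S : Set α | S ⊆ P \ {e} ∧ S.ncard = 3 ∧ p ∈ S ∧ q ∈ S} ∪
      {S : Set α | S ⊆ P \ {e} ∧ S.ncard = 3 ∧ r ∈ S ∧ s ∈ S})).ncard = 7 := by
    rw [ncard_insert_of_notMem hS3notin ((h𝒯fin.subset hK1sub).union (h𝒯fin.subset hK2sub)),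
      ncard_union_eq hdisj (h𝒯fin.subset hK1sub) (h𝒯fin.subset hK2sub), hK1c, hK2c]
  have hKsub : insert ({t, a, b} : Set α) ({S : Set α | S ⊆ P \ {e} ∧ S.ncard = 3 ∧ p ∈ S ∧ q ∈ S} ∪
      {S : Set α | S ⊆ P \ {e} ∧ S.ncard = 3 ∧ r ∈ S ∧ s ∈ S}) ⊆ {S : Set α | S ⊆ P \ {e} ∧ S.ncard = 3} := by
    rintro S (rfl | hS | hS)
    · exact ⟨hS3Q, hc3⟩
    · exact hK1sub hS
    · exact hK2sub hS
  have hkill : ∀ C, M.IsCircuit C → C.ncard = 4 → e ∈ C → C ⊆ P →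
      C \ {e} ∉ insert ({t, a, b} : Set α) ({S : Set α | S ⊆ P \ {e} ∧ S.ncard = 3 ∧ p ∈ S ∧ q ∈ S} ∪
        {S : Set α | S ⊆ P \ {e} ∧ S.ncard = 3 ∧ r ∈ S ∧ s ∈ S}) := by
    intro C hC hC4 heC hCP hmem
    rcases hmem with hmem | hmem | hmem
    · exact not_fourCircuit_of_triple_subset M hC hC4 (T := {t, a, b}) (hmem ▸ sdiff_subset) hc3 hruv
    · exact not_mem_kill_of_line M hr1 hpe hqe hpq C hC hC4 heC hCP hmem
    · exact not_mem_kill_of_line M hr2 hre hse hrs C hC hC4 heC hCP hmem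
  have := ncard_fourCircuitsThrough_in_plane_le_of_kill M hP hKsub hkill
  rw [hKc, hQ5] at this
  exact this.trans (by decide)


end S1

end PercRepro
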